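import Literature.AnabelianGeometry.EtaleTheta.TemperedFrobenioidCor38SubPreStepsWeakPartners
import HarnessLib

/-!
# [EtTh] Cor. 3.8 proof row C38-L02a `PreservesPreSteps` (F-2809): the cancellativity hypothesis of the kernel
# constraints is PER PRE-STEP — every MONO pre-step obeys them; the residual beyond them is carried by NON-MONO pre-steps

S. Mochizuki, *The étale theta function and its Frobenioid-theoretic manifestations*, Publ. RIMS **45** (2009)
[EtTh], Cor. 3.8, proof, PDF p. 81 l. 2–3 ("by [Mzk17], Theorem 3.4, (ii) … it follows that `Ψ` preserves
pre-steps") [cite: MochizukiEtTh2009, Cor 3.8 p.81]; S. Mochizuki, *The geometry of Frobenioids I*, Kyushu J. Math.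
**62** (2008) [FrdI], §0 pp. 14–18 (FSM-morphisms, FSMFF-type), Prop. 1.11 (vii) p. 31 ("every pre-step [of a
Frobenioid] is a monomorphism" — false for the junk divisor monoids the typed interface admits), Prop. 1.14 (ii) p. 36
(pre-steps among FSM-morphisms) [cite: MochizukiFrdI2008, §0 p.14].

abc-iut cell, block C / F (FACT-proving wave), seat abc-iut-f-128 (gen 15).  PROOF-ONLY file (0 definitions), hand #13
for the decision on the bare universal closure of `Cor38Hyp.PreservesPreSteps` (FACT-LIST F-2809; label of record
unchanged).  The kernel constraints of hands #10–#12 and of abc-iut-w6-d079 were stated under the GLOBAL hypothesis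
"`Φ₁(A)` cancellative for every `A`".  They only use it to make the pre-step under study a monomorphism of `C₁`; an
equivalence preserves monomorphisms and MONICITY OF THE BASE DESCENDS for linear arrows with no hypothesis at all
(abc-iut-w6-d079's `ModelFrobenioid.mono_baseMap_of_mono_of_degFr_eq_one`).  Hence, for EVERY record and with NO
hypothesis on the divisor monoids:
* **`Cor38Hyp.isFSM_baseMap_map_of_isPreStep_of_mono`** — the base of the image of a MONO pre-step is an FSM arrow;
* **`Cor38Hyp.isPreStep_map_or_of_isPreStep_of_mono`** — the residual dichotomy of hand #10 for a mono pre-step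
  (`Ψ φ` a pre-step, or `Base(Ψ φ)` a non-invertible FSM arrow with an FSMI-factorisation between base objects admitting
  no isomorphism);
* (hand #10's ω-chain sparsity follows verbatim for chains of MONO pre-steps from
  `IsOfFSMFFType.finite_not_isIso_of_chain` and the first item; not restated here);
* **`Cor38Hyp.isPreStep_map_of_hom_to_source_of_mono`** (+ `_of_thin`) — a mono pre-step whose target maps back to
  its source is preserved over bases where an FSM arrow with an arrow back is invertible / thin bases (hand #12);
* **`Cor38Hyp.not_mono_of_not_isPreStep_map_of_not_mono_baseMap`** — conversely, a pre-step whose image lies over a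
  NON-monic base arrow is NOT a monomorphism of `C₁`: some pull-back of its zero divisor fails to be cancellative.
READING (cell rule R5; FACT-LIST label NOT moved).  The residual splits cleanly PER PRE-STEP: a separating record moves
either (α) a MONO pre-step — then over an FSM arrow between non-isomorphic base objects, sparsely along chains,
Frobenius-stably (hand #11), and never when the target maps back to a Frobenius power of the source over a no-return
base — or (β) a NON-MONO pre-step `(1, f, Z, u)`: one with a pull-back `a^*Z` of its zero divisor that is not
cancellative in `Φ₁(W)` (the "`S₃/⟨(12)⟩ → *`" / `𝔻 = {X ⟲ τ ⇉ 0 → 1}` non-monic residual of the F-lit census lives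
entirely in (β)).  No [FrdI] Thm. 3.4 input; no Frobenioid axiom; vocabulary clauses untouched.  HONEST FRAMING:
bookkeeping about OUR typed Def. 3.6 interface (print's Cor. 3.8 quotes [FrdI] Thm. 3.4 (ii) for genuine Frobenioids,
whose pre-steps ARE monomorphisms by [FrdI] Prop. 1.11 (vii)); proved-as-typed ≠ proved-in-print; nothing here bears on
[IUTchIII] Cor. 3.12; no side taken; a FACT row is an assumption label; typed ≠ proved.
-/

namespace Literature.AnabelianGeometry.EtaleTheta

open CategoryTheory Opposite Literature.AlgebraicGeometry.Frobenioids
open ModelFrobenioid (degFr baseMap)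

universe u₀ v₀ u v w

variable {D₀ : Type u₀} [Category.{v₀} D₀] {V : FrdIMonoidStub.{w}}
  {T : RealifiedDivisorMonoids (D₀ := D₀) V} {D : Type u} [Category.{v} D] {VD : FrdICatStub.{u, v, w} D}

section Rows

variable {D₀' : Type u₀} [Category.{v₀} D₀'] {T' : RealifiedDivisorMonoids (D₀ := D₀') V}
  {D' : Type u} [Category.{v} D'] {VD' : FrdICatStub.{u, v, w} D'}
  {C₁ : TemperedFrobenioid T D VD} {C₂ : TemperedFrobenioid T' D' VD'}

namespace Cor38Hyp

variable (h : Cor38Hyp C₁ C₂)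

/-- **Every record, no hypothesis on `Φ`: the base of the image of a MONO pre-step is an FSM arrow of `D₂`** (linear:
abc-iut-f-151; fiberwise-surjective base: abc-iut-w6-d057; `Ψ φ` is mono and monicity descends for linear arrows:
abc-iut-w6-d079). [cite: MochizukiEtTh2009, Cor 3.8 p.81] -/
theorem isFSM_baseMap_map_of_isPreStep_of_mono {X Y : C₁.category} (φ : X ⟶ Y) [Mono φ]
    (hφ : C₁.opsData.IsPreStep φ) : IsFSM (baseMap (h.Ψ.functor.map φ)) := by
  haveI : Mono (h.Ψ.functor.map φ) := h.mono_map_of_mono φ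
  exact ⟨h.isFiberwiseSurjective_baseMap_map_of_isPreStep φ hφ,
    ModelFrobenioid.mono_baseMap_of_mono_of_degFr_eq_one _ (h.isLinear_map_of_isPreStep φ hφ)⟩

/-- The mirror for `Ψ⁻¹`: the base of the image of a mono pre-step of `C₂` is an FSM arrow of `D₁`.
[cite: MochizukiEtTh2009, Cor 3.8 p.81] -/
theorem isFSM_baseMap_inverse_map_of_isPreStep_of_mono {X Y : C₂.category} (φ : X ⟶ Y) [Mono φ]
    (hφ : C₂.opsData.IsPreStep φ) : IsFSM (baseMap (h.Ψ.inverse.map φ)) := by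
  haveI : Mono (h.Ψ.inverse.map φ) := h.mono_inverse_map_of_mono φ
  exact ⟨h.isFiberwiseSurjective_baseMap_inverse_map_of_isPreStep φ hφ,
    ModelFrobenioid.mono_baseMap_of_mono_of_degFr_eq_one _ (h.isLinear_inverse_map_of_isPreStep φ hφ)⟩

/-- **The residual dichotomy for a MONO pre-step, every record, no hypothesis on `Φ`**: `Ψ φ` is a pre-step, or
`Base(Ψ φ)` is a non-invertible FSM arrow of `D₂` with an FSMI-factorisation of positive length between base objects
admitting NO isomorphism. [cite: MochizukiEtTh2009, Cor 3.8 p.81] -/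
theorem isPreStep_map_or_of_isPreStep_of_mono {X Y : C₁.category} (φ : X ⟶ Y) [Mono φ]
    (hφ : C₁.opsData.IsPreStep φ) :
    C₂.opsData.IsPreStep (h.Ψ.functor.map φ) ∨
      (¬ IsIso (baseMap (h.Ψ.functor.map φ)) ∧
        (∃ n, 0 < n ∧ IsFSMIChain (baseMap (h.Ψ.functor.map φ)) n) ∧
        IsEmpty ((h.Ψ.functor.obj X).base ≅ (h.Ψ.functor.obj Y).base)) := by
  have hlin := h.isLinear_map_of_isPreStep φ hφ
  have hFSM := h.isFSM_baseMap_map_of_isPreStep_of_mono φ hφ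
  by_cases hi : IsIso (baseMap (h.Ψ.functor.map φ))
  · exact Or.inl ((C₂.opsData_isPreStep_iff _).2 ⟨hlin, hi⟩)
  · refine Or.inr ⟨hi, ?_, ⟨fun e => hi ?_⟩⟩
    · obtain ⟨n, hn⟩ := h.fsmff.2.factors _ hFSM hi
      exact ⟨n, hn.pos, hn⟩
    · have hFSM' : IsFSM (baseMap (h.Ψ.functor.map φ) ≫ e.inv) := hFSM.comp (IsFSM.of_isIso e.inv)
      haveI := h.fsmff.2.isIso_of_isFSM_of_isEndomorphism _ hFSM'
      exact (C₂.isTotallyEpimorphic.isIso_of_isIso_comp (baseMap (h.Ψ.functor.map φ)) e.inv).2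

/-- **A MONO pre-step whose target maps back to its source is preserved** over bases in which an FSM arrow admitting
an arrow back is invertible (every record, no hypothesis on `Φ`). [cite: MochizukiEtTh2009, Cor 3.8 p.81] -/
theorem isPreStep_map_of_hom_to_source_of_mono
    (hD' : ∀ ⦃A A' : D'⦄ (g : A ⟶ A'), IsFSM g → Nonempty (A' ⟶ A) → IsIso g)
    {P Q : C₁.category} (φ : P ⟶ Q) [Mono φ] (hφ : C₁.opsData.IsPreStep φ) (ψ : Q ⟶ P) :
    C₂.opsData.IsPreStep (h.Ψ.functor.map φ) :=
  (C₂.opsData_isPreStep_iff _).2 ⟨h.isLinear_map_of_isPreStep φ hφ,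
    hD' _ (h.isFSM_baseMap_map_of_isPreStep_of_mono φ hφ) ⟨baseMap (h.Ψ.functor.map ψ)⟩⟩

/-- The thin-base instance: over a thin `D₂`, a MONO pre-step of `C₁` whose target admits a morphism back to its
source is carried to a pre-step. [cite: MochizukiEtTh2009, Cor 3.8 p.81] -/
theorem isPreStep_map_of_hom_to_source_of_mono_of_thin [Quiver.IsThin D']
    {P Q : C₁.category} (φ : P ⟶ Q) [Mono φ] (hφ : C₁.opsData.IsPreStep φ) (ψ : Q ⟶ P) :
    C₂.opsData.IsPreStep (h.Ψ.functor.map φ) :=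
  h.isPreStep_map_of_hom_to_source_of_mono
    (fun _ _ g _ ⟨t⟩ => isIso_of_hom_back_of_thin C₂.isTotallyEpimorphic g t) φ hφ ψ

/-- **The non-mono residual**: if the image of a pre-step `φ` of `C₁` lies over a NON-monic base arrow of `D₂`, then
`φ` is NOT a monomorphism of `C₁` — so (for a linear base-isomorphism `(1, f, Z, u)`) some pull-back of its zero divisor
is not cancellative. [cite: MochizukiEtTh2009, Cor 3.8 p.81] -/
theorem not_mono_of_not_mono_baseMap_map {X Y : C₁.category} (φ : X ⟶ Y) (hφ : C₁.opsData.IsPreStep φ)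
    (hb : ¬ Mono (baseMap (h.Ψ.functor.map φ))) : ¬ Mono φ := fun hm => by
  haveI := hm
  exact hb (h.isFSM_baseMap_map_of_isPreStep_of_mono φ hφ).2

end Cor38Hyp

end Rows

end Literature.AnabelianGeometry.EtaleTheta
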